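/-
Copyright (c) 2026 the pub-hodgecm-mathlib formalisation cell (harness21).  Prover seat hodgecm-mathlib-LH4-p18 (g3), Track A «FOUR-FRAME» hand on VALVE loan to
Track B «K2-LIT», #184♮ = hLiu418 = `stmt-HodgeConjecture-24832`; socket #42F′, FACE-G L2 (W-orb), RULING M-158y «(C2) CLOSURE ORGAN» (LEAD F0P6-plan (g14),
2026-09-04T23:42:05Z), file (C2-i); desk K2Liu-p09 (g8) ∕ K2Liu-p10 (g6).
THEOREMS ONLY (no `def`, no `instance`, no notation, no named-fact hypothesis, no `sorry`).
-/
import Literature.Analysis.SegalBargmann.SchwartzTensorPi     -- ★ σ15: `tensorPi`, `hermitePi_eq_tensorPi`; brings ★ `hermitePi`, `hasSum_hermiteCoeff_smul_hermitePi` (Hermite expansion IN `𝓢`)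
import HarnessLib

/-!
# Crux `HLiu418`, socket #42F′, FACE-G L2 (W-orb), (C2) CLOSURE ORGAN, file (C2-i) — `K2LiuArchSchwartzPlaceProductDense`:
# THE SPAN OF PLACE-PRODUCT VECTORS IS DENSE IN THE SCHWARTZ SPACE (Hermite functions are products; the Hermite expansion converges in `𝓢`)

Cell `hodgecm-mathlib`, crux item hLiu418 = `stmt-HodgeConjecture-24832` (helper lane `--supports … --as helper`, count-neutral), route of record `HCCMUnconditional`;
squad K2 ∕ K2Liu, road `K2_Liu`, socket #42F′ `firstTermIdentity…`, FACE-G, hole (W-orb) «the archimedean Weil orbit `t ↦ ω_∞(exp tX, 1) Ψ` is weakly differentiable at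
EVERY Schwartz vector `Ψ ∈ 𝓢(X_∞)`».  RULING M-158y: road (C2) «CLOSURE ORGAN» — (C2-org) ★-cand `K2LiuArchOrbitDerivClosure` (K2Liu-p09 (g8)): a one-parameter group of
CLMs on `𝓢` with continuous orbits and a weak derivative law with derivative `A d` on a DENSE set `D` has the law at every vector (`hasDerivAt_orbit_schwartz_of_dense`,
`thetaOrbitLetter_of_dense (D) (hD : Dense D) …`); (C2-B) the product law on full place-products + its globalisation (LH4-p05 (g10)); (C2-iii′) orbit continuity
(K2Liu-p10 (g6)); and THIS FILE (C2-i): **`Dense D` for `D :=` the span of place-product vectors** — LH4-p05's census `CENSUS-Worb.v1` 794d93174c8bd0ca §2 (B): the vectors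
on which the (G2-W2) smoothness theory runs are the σ-products `𝒥⁻¹(Φ₁ ⊠ Φ₂)` (`⊠ =` ★ σ15 `tensorPi`, `𝒥` = the σ-variables identification of ★ `K2LiuSwSectionPlaceSmooth`
`carrierConjEquiv_eq_symm_archSectionRepJ`, a composite of ★ `schwartzTransport`s: a CONTINUOUS LINEAR EQUIVALENCE `𝓢(X_∞) ≃L[ℂ] 𝓢(ℝ^{σ₁ ⊕ σ₂}, ℂ)`).
THE MATHEMATICS (Reed–Simon I Thm V.13 ∕ Folland 1989 §1.7, all ★ in the tree's σ15 topic): every `f ∈ 𝓢(ℝ^σ, ℂ)` is the sum IN THE SCHWARTZ TOPOLOGY of its Hermite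
series (★ `hasSum_hermiteCoeff_smul_hermitePi`), so the span of the Hermite functions `hermitePi α` is dense; on `ℝ^{σ₁ ⊕ σ₂}` every Hermite function IS a product
`hermitePi α₁ ⊠ hermitePi α₂` (★ `hermitePi_eq_tensorPi`), so the span of the products `Φ₁ ⊠ Φ₂` is dense; and density of a span transports along any continuous linear
equivalence.  CURRENCY-FREE: the consumer instantiates `𝒥` with its own composite and `P` with its own product set.
* §1 `mem_closure_span_hermitePi`, **`dense_span_hermitePi`** — `Dense (span ℂ (range hermitePi))` in `𝓢(ℝ^σ, ℂ)`; `dense_span_of_range_hermitePi_subset` (any `S ⊇ range hermitePi`).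
* §2 **`dense_span_tensorPi`** — `Dense (span ℂ {Φ₁ ⊠ Φ₂})` in `𝓢(ℝ^{σ₁ ⊕ σ₂}, ℂ)`.
* §3 TRANSPORT along a continuous linear equivalence `𝒥 : E ≃L[ℂ] F` (abstract topological `ℂ`-modules): `dense_span_image_symm_of_dense_span` (`Dense (span S)` in `F` ⇒
  `Dense (span (𝒥.symm '' S))` in `E`), and the two heads the (C2) organ consumes: **`dense_span_symm_tensorPi`** — `Dense (span ℂ {𝒥.symm (Φ₁ ⊠ Φ₂)} : Set E)` for ANY
  `𝒥 : E ≃L[ℂ] 𝓢(ℝ^{σ₁ ⊕ σ₂}, ℂ)` — and **`dense_span_of_symm_hermitePi_mem`** — `Dense (span ℂ P)` for ANY `P ⊆ E` containing the transported Hermite functions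
  `𝒥.symm (hermitePi α)` (`𝒥 : E ≃L[ℂ] 𝓢(ℝ^σ, ℂ)`; e.g. `P :=` the FULL place-products over all archimedean places, which contain every `𝒥.symm (hermitePi α)` by
  iterating ★ `hermitePi_eq_tensorPi`).
[ReedSimonI1980, Thm V.13] [Folland1989, §1.7] [Treves1967, Thm 51.6].
HONEST LABEL.  Count-neutral helper, closes no socket (pure functional analysis over ★ σ15): `HC_CM` is proved only modulo the 7 printed citations (2 remaining named
inputs: hLiu418 = `stmt-HodgeConjecture-24832`, h413 = `stmt-HodgeConjecture-24833`) until rung 0 closes.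

## References
* [ReedSimonI1980] M. Reed, B. Simon, *Methods of Modern Mathematical Physics I: Functional Analysis* (1980): Theorem V.13 and Appendix to §V.3 (the `N`-representation of `𝒮`:
  Hermite expansions converge in `𝒮(ℝⁿ)`).
* [Folland1989] G. B. Folland, *Harmonic Analysis in Phase Space*, Annals of Math. Studies 122 (1989): §1.7 (Hermite functions on `ℝⁿ` as products of one-variable ones).
* [Treves1967] F. Trèves, *Topological Vector Spaces, Distributions and Kernels* (1967): Thm 51.6 (`𝒮(ℝ^m) ⊗ 𝒮(ℝ^n)` is dense in `𝒮(ℝ^{m+n})`).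
-/

set_option autoImplicit false
set_option linter.dupNamespace false -- the mandated namespace repeats `HodgeConjecture.HodgeConjecture`

noncomputable section

open Filter Topology SchwartzMap
open Literature.Analysis.SegalBargmann

namespace Summit.HodgeConjecture.HodgeConjecture.Cruxes.HLiu418.K2LiuArchSchwartzPlaceProductDense

/-! ## §1 The Hermite span is dense in `𝓢(ℝ^σ, ℂ)` -/

section Hermite

variable {σ : Type*} [Fintype σ] [DecidableEq σ]

/-- every `f ∈ 𝓢(ℝ^σ, ℂ)` lies in the closure of the span of the Hermite functions: it is the sum IN `𝓢` of its Hermite series (★ `hasSum_hermiteCoeff_smul_hermitePi`), whose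
partial sums lie in the span. [cite: ReedSimonI1980, Thm V.13] [cite: Folland1989, §1.7] -/
theorem mem_closure_span_hermitePi (f : SchwartzMap (σ → ℝ) ℂ) :
    f ∈ closure ((Submodule.span ℂ (Set.range (hermitePi (σ := σ))) : Submodule ℂ (SchwartzMap (σ → ℝ) ℂ)) : Set (SchwartzMap (σ → ℝ) ℂ)) :=
  mem_closure_of_tendsto (hasSum_hermiteCoeff_smul_hermitePi f) (Eventually.of_forall fun _ =>
    Submodule.sum_mem _ fun β _ => Submodule.smul_mem _ _ (Submodule.subset_span ⟨β, rfl⟩))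

/-- **THE SPAN OF THE HERMITE FUNCTIONS IS DENSE IN `𝓢(ℝ^σ, ℂ)`** (Schwartz topology). [cite: ReedSimonI1980, Thm V.13] [cite: Folland1989, §1.7] -/
theorem dense_span_hermitePi :
    Dense ((Submodule.span ℂ (Set.range (hermitePi (σ := σ))) : Submodule ℂ (SchwartzMap (σ → ℝ) ℂ)) : Set (SchwartzMap (σ → ℝ) ℂ)) :=
  fun f => mem_closure_span_hermitePi f

/-- any set of Schwartz functions containing the Hermite functions spans a dense subspace. [cite: ReedSimonI1980, Thm V.13] -/
theorem dense_span_of_range_hermitePi_subset {S : Set (SchwartzMap (σ → ℝ) ℂ)} (hS : Set.range (hermitePi (σ := σ)) ⊆ S) :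
    Dense ((Submodule.span ℂ S : Submodule ℂ (SchwartzMap (σ → ℝ) ℂ)) : Set (SchwartzMap (σ → ℝ) ℂ)) :=
  dense_span_hermitePi.mono (Submodule.span_mono hS)

end Hermite

/-! ## §2 The span of the products in separate variables is dense in `𝓢(ℝ^{σ₁ ⊕ σ₂}, ℂ)` -/

section Tensor

variable {σ₁ σ₂ : Type*} [Fintype σ₁] [Fintype σ₂] [DecidableEq σ₁] [DecidableEq σ₂]

/-- **THE SPAN OF THE PRODUCTS `Φ₁ ⊠ Φ₂` (★ σ15 `tensorPi`) IS DENSE IN `𝓢(ℝ^{σ₁ ⊕ σ₂}, ℂ)`**: every Hermite function on `ℝ^{σ₁ ⊕ σ₂}` is such a product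
(★ `hermitePi_eq_tensorPi`) and the Hermite span is dense (§1). [cite: Folland1989, §1.7] [cite: Treves1967, Thm 51.6] -/
theorem dense_span_tensorPi :
    Dense ((Submodule.span ℂ {h : SchwartzMap (σ₁ ⊕ σ₂ → ℝ) ℂ | ∃ (f : SchwartzMap (σ₁ → ℝ) ℂ) (g : SchwartzMap (σ₂ → ℝ) ℂ), h = tensorPi f g} :
      Submodule ℂ (SchwartzMap (σ₁ ⊕ σ₂ → ℝ) ℂ)) : Set (SchwartzMap (σ₁ ⊕ σ₂ → ℝ) ℂ)) :=
  dense_span_of_range_hermitePi_subset (by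
    rintro _ ⟨α, rfl⟩
    exact ⟨_, _, hermitePi_eq_tensorPi α⟩)

end Tensor

/-! ## §3 Transport along a continuous linear equivalence; the two heads of the (C2) organ -/

section Transport

variable {E F : Type*} [AddCommGroup E] [Module ℂ E] [TopologicalSpace E] [AddCommGroup F] [Module ℂ F] [TopologicalSpace F]

/-- **DENSITY OF A SPAN TRANSPORTS ALONG A CONTINUOUS LINEAR EQUIVALENCE**: `𝒥 : E ≃L[ℂ] F`, `Dense (span S)` in `F` ⇒ `Dense (span (𝒥.symm '' S))` in `E`
(`𝒥.symm '' span S ⊆ span (𝒥.symm '' S)` by linearity, and a homeomorphism carries dense sets to dense sets). [folklore] -/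
theorem dense_span_image_symm_of_dense_span (𝒥 : E ≃L[ℂ] F) {S : Set F} (hS : Dense ((Submodule.span ℂ S : Submodule ℂ F) : Set F)) :
    Dense ((Submodule.span ℂ (𝒥.symm '' S) : Submodule ℂ E) : Set E) := by
  -- `𝒥⁻¹(span S) ⊆ span (𝒥⁻¹ S)` (linearity), and `𝒥⁻¹(span S)` is dense (a homeomorphism carries dense sets to dense sets)
  have hsub : 𝒥.symm '' ((Submodule.span ℂ S : Submodule ℂ F) : Set F) ⊆ ((Submodule.span ℂ (𝒥.symm '' S) : Submodule ℂ E) : Set E) := by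
    rintro _ ⟨x, hx, rfl⟩
    refine Submodule.span_induction (p := fun x _ => 𝒥.symm x ∈ Submodule.span ℂ (𝒥.symm '' S)) ?_ ?_ ?_ ?_ hx
    · exact fun x hx => Submodule.subset_span ⟨x, hx, rfl⟩
    · rw [map_zero]; exact Submodule.zero_mem _
    · intro x y _ _ hx hy; rw [map_add]; exact Submodule.add_mem _ hx hy
    · intro c x _ hx; rw [map_smul]; exact Submodule.smul_mem _ c hx
  exact (𝒥.symm.surjective.denseRange.dense_image 𝒥.symm.continuous hS).mono hsub

variable {σ₁ σ₂ : Type*} [Fintype σ₁] [Fintype σ₂] [DecidableEq σ₁] [DecidableEq σ₂]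

/-- **(C2-i) HEAD, TWO-FACTOR FORM — THE σ-PRODUCT VECTORS SPAN A DENSE SUBSPACE.**  For ANY continuous linear identification `𝒥 : E ≃L[ℂ] 𝓢(ℝ^{σ₁ ⊕ σ₂}, ℂ)` of a topological
`ℂ`-module `E` (read: `E := 𝓢(X_∞) = 𝓢((Fin n″ → mixedSpace L⁺), ℂ)`, `𝒥` the σ-variables identification of ★ `K2LiuSwSectionPlaceSmooth`, `σ₁` the variables at the place under `X`),
the vectors `𝒥⁻¹(Φ₁ ⊠ Φ₂)` span a DENSE subspace of `E`: `Dense (span ℂ {𝒥.symm (tensorPi Φ₁ Φ₂)})` — the `hD` of ★-cand `K2LiuArchOrbitDerivClosure.thetaOrbitLetter_of_dense` for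
`D :=` that span. [cite: Folland1989, §1.7] [cite: Treves1967, Thm 51.6] [cite: ReedSimonI1980, Thm V.13] -/
theorem dense_span_symm_tensorPi (𝒥 : E ≃L[ℂ] SchwartzMap (σ₁ ⊕ σ₂ → ℝ) ℂ) :
    Dense ((Submodule.span ℂ {d : E | ∃ (f : SchwartzMap (σ₁ → ℝ) ℂ) (g : SchwartzMap (σ₂ → ℝ) ℂ), d = 𝒥.symm (tensorPi f g)} : Submodule ℂ E) : Set E) := by
  have hset : {d : E | ∃ (f : SchwartzMap (σ₁ → ℝ) ℂ) (g : SchwartzMap (σ₂ → ℝ) ℂ), d = 𝒥.symm (tensorPi f g)} =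
      𝒥.symm '' {h : SchwartzMap (σ₁ ⊕ σ₂ → ℝ) ℂ | ∃ (f : SchwartzMap (σ₁ → ℝ) ℂ) (g : SchwartzMap (σ₂ → ℝ) ℂ), h = tensorPi f g} := by
    ext d
    simp only [Set.mem_setOf_eq, Set.mem_image]
    constructor
    · rintro ⟨f, g, rfl⟩
      exact ⟨tensorPi f g, ⟨f, g, rfl⟩, rfl⟩
    · rintro ⟨h, ⟨f, g, rfl⟩, rfl⟩
      exact ⟨f, g, rfl⟩
  rw [hset]
  exact dense_span_image_symm_of_dense_span 𝒥 dense_span_tensorPi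

variable {σ : Type*} [Fintype σ] [DecidableEq σ]

/-- **(C2-i) HEAD, ANY-PRODUCT-SET FORM — A SET OF VECTORS CONTAINING THE TRANSPORTED HERMITE FUNCTIONS SPANS A DENSE SUBSPACE.**  For ANY `𝒥 : E ≃L[ℂ] 𝓢(ℝ^σ, ℂ)` and ANY
`P ⊆ E` with `𝒥⁻¹(hermitePi α) ∈ P` for every multi-index `α` (e.g. `P :=` the FULL place-product vectors `𝒥⁻¹(⊠_v Φ_v)` over all archimedean places — each `hermitePi α` on
`ℝ^{⊕_v σ_v}` is such a product by iterating ★ `hermitePi_eq_tensorPi`): `Dense (span ℂ P)`. [cite: ReedSimonI1980, Thm V.13] [cite: Folland1989, §1.7] -/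
theorem dense_span_of_symm_hermitePi_mem (𝒥 : E ≃L[ℂ] SchwartzMap (σ → ℝ) ℂ) {P : Set E} (hP : ∀ α : σ →₀ ℕ, 𝒥.symm (hermitePi α) ∈ P) :
    Dense ((Submodule.span ℂ P : Submodule ℂ E) : Set E) := by
  have h := dense_span_image_symm_of_dense_span 𝒥 (dense_span_hermitePi (σ := σ))
  refine h.mono (Submodule.span_mono ?_)
  rintro _ ⟨_, ⟨α, rfl⟩, rfl⟩
  exact hP α

end Transport

end Summit.HodgeConjecture.HodgeConjecture.Cruxes.HLiu418.K2LiuArchSchwartzPlaceProductDense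

end
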